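/-
Copyright: public-domain mathematics; formalisation produced inside the b2b autopsy cell `lwe-quantum-autopsy`
(Part 1, generation 15).  Source analysed: Yilei Chen, "Quantum Algorithms for Lattice Problems",
IACR ePrint 2024/555, version of 2024-04-18 (WITHDRAWN by the author: "Step 9 of the algorithm contains a
bug, which I don't know how to fix").  Bib key `ChenQuantumLattice2024`.
-/
import Literature.Computability.Cryptography.ChenQuantumLWEGeneralMeasurement
import Literature.Computability.Cryptography.ChenQuantumLWECoarsening

/-!
# Chen 2024 (withdrawn), Lemma 3.13 completed: Step 8 is an EXACT non-demolition procedure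

REPRODUCTION / TYPED SKELETON OF A CLAIMED RESULT UNDER ADJUDICATION — header required by the tree's
literature rule.  Author: Yilei Chen.  Title: *Quantum Algorithms for Lattice Problems*.  Venue: IACR
Cryptology ePrint Archive, Paper 2024/555, version of 18 April 2024 (the main claim WITHDRAWN by the author,
title-page note; the bug is in Step 9, p. 37). [ChenQuantumLattice2024]  Printed page numbers.

HONEST FRAMING (bundle `papers/QuantumAdvantage/lwe-quantum-autopsy/`, Part 1): the value of this file is a
THEOREM — a positive, kernel-checked certificate that ONE step (Step 8, §3.5.8, Lemma 3.13) of a WITHDRAWN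
algorithm does exactly what its author says — NOT summit progress, no cryptanalytic claim in either
direction, no new algorithm; quantum lower bounds are out of scope.

## What is proved

`ChenQuantumLWEStepEight.lean` performs the four operations (8.i)–(8.iv) of Step 8 on the registers
(`Shape.phi7a … Shape.phi7d`) and proves Claim 3.14 for the state they produce (`Shape.claim314_phi7d`).
Lemma 3.13 (p. 32) says more: "we first perform four operations, then make a partial measurement, and
finally reverse the four operations (we will make sure that the four operations are reversible) … we will
learn `v′₁ mod D²p₁` without collapsing or modifying `|φ7⟩`."  This file proves the remaining half, in the
register model of §2 (amplitude functions on `ℤ_mⁿ`, unnormalised maps with their scalars recorded):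

* **The four operations are reversible, each by its adjoint.**  (8.iv) `QFT_{ℤ_mⁿ}`: the inverse transform
  `qftInv` (sign `+`) is the adjoint of `qft` (`dotProduct_qftInv_left`) and `qftInv (qft ψ) = mⁿ • ψ`
  (`qftInv_qft`, Fourier inversion on `ℤ_mⁿ`; also `qft_qftInv`).  (8.iii) the kick: `kick (−g) (kick g ψ) = ψ`
  (`kick_neg_kick`).  (8.ii) "divide the register by `D`" (p. 33: "this operation is also reversible: we just
  'multiply by D' by creating `|0ⁿ mod D⟩` and interpreting them as the LSBs"): `Shape.multiplyByD` is the
  adjoint of `Shape.divideByD` (`dotProduct_multiplyByD_left`), an isometry (`dotProduct_multiplyByD_multiplyByD`),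
  `divideByD ∘ multiplyByD = id` (`divideByD_multiplyByD`), and `multiplyByD ∘ divideByD = id` ON THE STATES
  SUPPORTED IN `Dℤ` (`multiplyByD_divideByD`) — which `|φ7.a⟩` is (`phi7a_apply_ne_zero`, p. 33 "we can do so
  because `2Djx + v′ + (M/2)k ∈ Dℤⁿ`").  (8.i) Lemma 2.17's domain extension `ℤ_M → ℤ_{DM}`: the un-extension
  `domainExtAdj` (run the extension circuit backwards and project the digit register onto the state it was
  created in) is the adjoint of `domainExt` (`dotProduct_domainExtAdj_left`), `domainExt` is `C^{n/2}` times an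
  isometry (`dotProduct_domainExt_domainExt`) and `domainExtAdj C (domainExt C ψ) = Cⁿ • ψ`
  (`domainExtAdj_domainExt`).
* **The fifth operation is sure and disturbs nothing** (p. 34: "we compute `w₁ mod Dp₁` in a new register,
  then measure the new register … This measurement does not collapse the state `|φ7.d⟩`, so the residual
  state is `|φ7.e⟩ = |φ7.d⟩`"): its Lüders branch for outcome `r` is the projector onto `{w : w₀ ≡ r (mod Dp₁)}`
  (`Shape.fifthOp`), and `fifthOp r |φ7.d⟩ = |φ7.d⟩` for `r = v′₀/D mod Dp₁` (`Shape.read8Value`), `= 0` for every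
  other `r` (`Shape.fifthOp_phi7d`; `Shape.isNonDisturbing_fifthOp` in the vocabulary of Part 2's
  `ChenQuantumLWENonDisturbing`).  The outcome read is `v′₀ mod D²p₁ = step8Output`
  (`Shape.step8Output_eq_D_mul_read8Value`).
* **Reversing the four operations returns `|φ7⟩` exactly** (p. 34: "Next we reverse the previous four
  operations and get back to `|φ8⟩ = |φ7⟩` … we learn `v′₁ mod D²p₁` without affecting the state `|φ7⟩` at all"):
  `Shape.reverse8 (fifthOp read8Value |φ7.d⟩) = (DM)^{n+1} • |φ7⟩` (`Shape.reverse8_fifthOp_phi7d`; the scalar is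
  the product of the recorded normalisations, `Shape.scalar8_ne_zero`), via the general statements
  `Shape.reverse8_forward8` (every input supported in `Dℤ` comes back), `Shape.dotProduct_reverse8_left`
  (`reverse8` IS the adjoint of the four operations `forward8`, i.e. their circuit run backwards) and
  `Shape.dotProduct_forward8_forward8` (the four operations are `(DM)^{(n+1)/2}` times an isometry there).
  Packaged: `Shape.lemma313`.

Together with `Shape.claim314_phi7d` and the Step-8 ceiling theorems this closes the bundle's account of
§3.5.8: Step 8 is sound in full — it is Step 9 (p. 37) that fails (`ChenQuantumLWEStepNine`,
`ChenQuantumLWEDisplayRefutation`).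

## Modelling choices, and what is NOT here

States are unnormalised amplitude functions (`Ket`); a physical state is a ray, so "returns `|φ7⟩`" is
`= c • phi7` with the scalar `c ≠ 0` computed.  Each register operation of §2 is recorded as the linear map
on amplitudes the paper describes, its adjoint is DEFINED here and PROVED to be the adjoint and a left
inverse up to the recorded scalar — this is what "reversible" means for an isometric step.  The
measurement in (8.ii) of "the modulo-`D` part" is not re-modelled (its outcome is surely `0ⁿ⁺¹` on `|φ7.a⟩`,
`phi7a_apply_ne_zero` in `ChenQuantumLWEStepEight`).  Complexity ("poly(n) time") is not formalised.  No
claim about Steps 1–7 (the complex-Gaussian analysis, Claim 3.12) is made: `|φ7⟩` is eq. (35) as printed.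
-/

namespace Literature.Computability.Cryptography.Chen2024

open scoped BigOperators

/-! ### (8.iv)⁻¹ and (8.iii)⁻¹ in general: Fourier inversion on `ℤ_mⁿ`, the opposite kick -/

/-- The inverse transform `QFT⁻¹_{ℤ_mⁿ}`: kernel `e^{+2πi⟨z,u⟩/m}`, unnormalised (Lemma 2.12 normalises both
directions by `m^{-n/2}`; here `QFT⁻¹ ∘ QFT = mⁿ·id`, `qftInv_qft`). [cite: ChenQuantumLattice2024, Lemma 2.12 p. 12] -/
noncomputable def qftInv {n m : ℕ} [NeZero m] (ψ : Ket n m) : Ket n m :=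
  fun u => ∑ z : Fin n → ZMod m, ψ z * e ((((∑ i, (z i).val * (u i).val : ℕ) : ℚ)) / m)

/-- `QFT⁻¹ ψ (u) = Σ_z ψ(z) ψ_m(⟨z,u⟩)` with `ψ_m = ZMod.stdAddChar`. [cite: ChenQuantumLattice2024, Lemma 2.12 p. 12] -/
theorem qftInv_apply_eq_sum_stdAddChar {n m : ℕ} [NeZero m] (ψ : Ket n m) (u : Fin n → ZMod m) :
    qftInv ψ u = ∑ z, ψ z * ZMod.stdAddChar (∑ t, z t * u t) := by
  unfold qftInv
  refine Finset.sum_congr rfl fun z _ => ?_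
  congr 1
  rw [show (∑ i, (z i).val * (u i).val : ℕ) = dotVal z u from rfl,
    show (((dotVal z u : ℕ) : ℚ)) = (((dotVal z u : ℕ) : ℤ) : ℚ) by push_cast; rfl,
    e_intCast_div_eq_stdAddChar, Int.cast_natCast, natCast_dotVal]

/-- **Fourier inversion on `ℤ_mⁿ`:** `QFT⁻¹ (QFT ψ) = mⁿ • ψ` — operation (8.iv) is undone by `QFT⁻¹`
(orthogonality of the characters of `ℤ_mⁿ`, `sum_stdAddChar_linForm`). [cite: ChenQuantumLattice2024, Lemma 2.12 p. 12] -/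
theorem qftInv_qft {n m : ℕ} [NeZero m] (ψ : Ket n m) : qftInv (qft ψ) = ((m : ℂ) ^ n) • ψ := by
  classical
  funext u
  rw [Pi.smul_apply, smul_eq_mul, qftInv_apply_eq_sum_stdAddChar]
  have step : ∀ z : Fin n → ZMod m,
      qft ψ z * ZMod.stdAddChar (∑ t, z t * u t) = ∑ y, ψ y * ZMod.stdAddChar (∑ t, (u - y) t * z t) := by
    intro z
    rw [qft_apply_eq_sum_stdAddChar, Finset.sum_mul]
    refine Finset.sum_congr rfl fun y _ => ?_
    rw [mul_assoc, ← AddChar.map_add_eq_mul]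
    congr 2
    rw [← Finset.sum_neg_distrib, ← Finset.sum_add_distrib]
    exact Finset.sum_congr rfl fun t _ => by simp only [Pi.sub_apply]; ring
  simp_rw [step]
  rw [Finset.sum_comm]
  simp_rw [← Finset.mul_sum, sum_stdAddChar_linForm, sub_eq_zero]
  rw [Finset.sum_eq_single u (fun y _ hy => by rw [if_neg (Ne.symm hy), mul_zero])
    (fun h => absurd (Finset.mem_univ u) h), if_pos rfl, mul_comm]

/-- `QFT (QFT⁻¹ ψ) = mⁿ • ψ`: `QFT⁻¹` is a two-sided inverse up to the scalar, i.e. `m^{-n/2}·QFT` is unitary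
with inverse `m^{-n/2}·QFT⁻¹`. [cite: ChenQuantumLattice2024, Lemma 2.12 p. 12] -/
theorem qft_qftInv {n m : ℕ} [NeZero m] (ψ : Ket n m) : qft (qftInv ψ) = ((m : ℂ) ^ n) • ψ := by
  classical
  funext u
  rw [Pi.smul_apply, smul_eq_mul, qft_apply_eq_sum_stdAddChar]
  have step : ∀ z : Fin n → ZMod m,
      qftInv ψ z * ZMod.stdAddChar (-(∑ t, z t * u t))
        = ∑ y, ψ y * ZMod.stdAddChar (∑ t, (y - u) t * z t) := by
    intro z
    rw [qftInv_apply_eq_sum_stdAddChar, Finset.sum_mul]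
    refine Finset.sum_congr rfl fun y _ => ?_
    rw [mul_assoc, ← AddChar.map_add_eq_mul]
    congr 2
    rw [← Finset.sum_neg_distrib, ← Finset.sum_add_distrib]
    exact Finset.sum_congr rfl fun t _ => by simp only [Pi.sub_apply]; ring
  simp_rw [step]
  rw [Finset.sum_comm]
  simp_rw [← Finset.mul_sum, sum_stdAddChar_linForm, sub_eq_zero]
  rw [Finset.sum_eq_single u (fun y _ hy => by rw [if_neg hy, mul_zero])
    (fun h => absurd (Finset.mem_univ u) h), if_pos rfl, mul_comm]

/-- **`QFT⁻¹` is the adjoint of `QFT`:** `⟨QFT⁻¹ φ | ψ⟩ = ⟨φ | QFT ψ⟩` (so reversing (8.iv) is running the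
`QFT` circuit backwards; cf. `dotProduct_qft_qft`). [cite: ChenQuantumLattice2024, Lemma 2.12 p. 12] -/
theorem dotProduct_qftInv_left {n m : ℕ} [NeZero m] (φ ψ : Ket n m) :
    star (qftInv φ) ⬝ᵥ ψ = star φ ⬝ᵥ qft ψ := by
  classical
  simp only [dotProduct, Pi.star_apply, Complex.star_def]
  simp_rw [qftInv_apply_eq_sum_stdAddChar, qft_apply_eq_sum_stdAddChar, map_sum, map_mul, Finset.sum_mul,
    Finset.mul_sum]
  rw [Finset.sum_comm]
  refine Finset.sum_congr rfl fun z _ => Finset.sum_congr rfl fun u _ => ?_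
  rw [← AddChar.map_neg_eq_conj]
  have h : (-(∑ t, z t * u t)) = -(∑ t, u t * z t) := by
    rw [Finset.sum_congr rfl fun t _ => mul_comm (z t) (u t)]
  rw [h]
  ring

/-- The kick is linear: `kick g (c • ψ) = c • kick g ψ`. [cite: ChenQuantumLattice2024, Lemma 2.13 p. 13] -/
theorem kick_const_smul {n m : ℕ} (g : (Fin n → ZMod m) → ℚ) (c : ℂ) (ψ : Ket n m) :
    kick g (c • ψ) = c • kick g ψ := by
  funext z
  simp only [kick, Pi.smul_apply, smul_eq_mul, mul_assoc]

/-- **(8.iii) is undone by the opposite kick:** `kick (−g) (kick g ψ) = ψ`. [cite: ChenQuantumLattice2024, Lemma 2.13 p. 13] -/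
theorem kick_neg_kick {n m : ℕ} (g : (Fin n → ZMod m) → ℚ) (ψ : Ket n m) :
    kick (fun z => -g z) (kick g ψ) = ψ := by
  funext z
  show ψ z * e (g z) * e (-g z) = ψ z
  have h0 : e (g z) * e (-g z) = 1 := by
    rw [← e_add, add_neg_cancel]
    simpa using e_intCast 0
  rw [mul_assoc, h0, mul_one]

/-- **The opposite kick is the adjoint of the kick:** `⟨kick (−g) φ | ψ⟩ = ⟨φ | kick g ψ⟩` (a diagonal unitary;
cf. `dotProduct_kick_kick`). [cite: ChenQuantumLattice2024, Lemma 2.13 p. 13] -/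
theorem dotProduct_kick_neg_left {n m : ℕ} [NeZero m] (g : (Fin n → ZMod m) → ℚ) (φ ψ : Ket n m) :
    star (kick (fun z => -g z) φ) ⬝ᵥ ψ = star φ ⬝ᵥ kick g ψ := by
  have hφ : kick g (kick (fun z => -g z) φ) = φ := by
    simpa only [neg_neg] using kick_neg_kick (fun z => -g z) φ
  have h := dotProduct_kick_kick g (kick (fun z => -g z) φ) ψ
  rw [hφ] at h
  exact h.symm

/-! ### (8.i)⁻¹ in general: the un-extension, adjoint of Lemma 2.17's domain extension -/

/-- Coordinatewise reduction `ℤ_{CP}ⁿ → ℤ_Pⁿ` (the map `domainExt C` pulls back along). [folklore] -/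
def reduceMod {n P : ℕ} (C : ℕ) (z : Fin n → ZMod (C * P)) : Fin n → ZMod P :=
  fun i => ZMod.castHom (dvd_mul_left P C) (ZMod P) (z i)

/-- `domainExt C ψ (z) = ψ (z mod P)`. [cite: ChenQuantumLattice2024, Lemma 2.17 p. 14] -/
theorem domainExt_apply_reduceMod {n P : ℕ} (C : ℕ) (ψ : Ket n P) (z : Fin n → ZMod (C * P)) :
    domainExt C ψ z = ψ (reduceMod C z) := rfl

/-- The UN-EXTENSION `ℤ_{CP}ⁿ → ℤ_Pⁿ`: the amplitude at `x` is the sum of the amplitudes over the `Cⁿ` lifts of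
`x`.  This is Lemma 2.17 run backwards (undo `|x⟩|h⟩ ↦ |x + P·h⟩`, then project the digit register `|h⟩` onto
the uniform state it was prepared in) — the adjoint of `domainExt C` (`dotProduct_domainExtAdj_left`),
unnormalised. [cite: ChenQuantumLattice2024, Lemma 2.17 p. 14] -/
noncomputable def domainExtAdj {n P : ℕ} (C : ℕ) [NeZero (C * P)] (φ : Ket n (C * P)) : Ket n P :=
  fun x => ∑ z : Fin n → ZMod (C * P), if reduceMod C z = x then φ z else 0

/-- Every fibre of the coordinatewise reduction `ℤ_{CP}ⁿ → ℤ_Pⁿ` has exactly `Cⁿ` points. [folklore] -/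
theorem card_filter_reduceMod {n P : ℕ} (C : ℕ) [NeZero P] [NeZero (C * P)] (x : Fin n → ZMod P) :
    (Finset.univ.filter fun z : Fin n → ZMod (C * P) => reduceMod C z = x).card = C ^ n := by
  classical
  have h1 : (Finset.univ.filter fun z : Fin n → ZMod (C * P) => reduceMod C z = x)
      = Fintype.piFinset fun i => Finset.univ.filter fun t : ZMod (C * P) =>
          ZMod.castHom (dvd_mul_left P C) (ZMod P) t = x i := by
    ext z
    simp only [Finset.mem_filter, Finset.mem_univ, true_and, Fintype.mem_piFinset, reduceMod, funext_iff]
  have h2 : ∀ i, (Finset.univ.filter fun t : ZMod (C * P) =>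
      ZMod.castHom (dvd_mul_left P C) (ZMod P) t = x i).card = C := fun i =>
    Nat.eq_of_mul_eq_mul_right (NeZero.pos P) (card_filter_castHom_mul (dvd_mul_left P C) (x i))
  rw [h1, Fintype.card_piFinset]
  simp_rw [h2]
  rw [Finset.prod_const, Finset.card_univ, Fintype.card_fin]

/-- **Lemma 2.17 is undone by the un-extension:** `domainExtAdj C (domainExt C ψ) = Cⁿ • ψ`.
[cite: ChenQuantumLattice2024, Lemma 2.17 p. 14] -/
theorem domainExtAdj_domainExt {n P : ℕ} (C : ℕ) [NeZero P] [NeZero (C * P)] (ψ : Ket n P) :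
    domainExtAdj C (domainExt C ψ) = ((C : ℂ) ^ n) • ψ := by
  classical
  funext x
  simp only [domainExtAdj, Pi.smul_apply, smul_eq_mul, domainExt_apply_reduceMod]
  rw [← Finset.sum_filter, Finset.sum_congr rfl (fun z hz => by rw [(Finset.mem_filter.1 hz).2] :
      ∀ z ∈ Finset.univ.filter (fun z : Fin n → ZMod (C * P) => reduceMod C z = x),
        ψ (reduceMod C z) = ψ x),
    Finset.sum_const, card_filter_reduceMod, nsmul_eq_mul]
  push_cast
  ring

/-- The un-extension is linear: `domainExtAdj C (c • φ) = c • domainExtAdj C φ`. [folklore] -/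
theorem domainExtAdj_const_smul {n P : ℕ} (C : ℕ) [NeZero (C * P)] (c : ℂ) (φ : Ket n (C * P)) :
    domainExtAdj C (c • φ) = c • domainExtAdj C φ := by
  classical
  funext x
  simp only [domainExtAdj, Pi.smul_apply, smul_eq_mul, Finset.mul_sum, mul_ite, mul_zero]

/-- The extension is linear: `domainExt C (c • ψ) = c • domainExt C ψ`. [cite: ChenQuantumLattice2024, Lemma 2.17 p. 14] -/
theorem domainExt_const_smul {n P : ℕ} (C : ℕ) (c : ℂ) (ψ : Ket n P) :
    domainExt C (c • ψ) = c • domainExt C ψ := rfl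

/-- **The un-extension is the adjoint of the extension:** `⟨domainExtAdj C φ | ψ⟩ = ⟨φ | domainExt C ψ⟩`.
[cite: ChenQuantumLattice2024, Lemma 2.17 p. 14] -/
theorem dotProduct_domainExtAdj_left {n P : ℕ} (C : ℕ) [NeZero P] [NeZero (C * P)] (φ : Ket n (C * P))
    (ψ : Ket n P) : star (domainExtAdj C φ) ⬝ᵥ ψ = star φ ⬝ᵥ domainExt C ψ := by
  classical
  simp only [dotProduct, Pi.star_apply, Complex.star_def, domainExtAdj, map_sum, Finset.sum_mul,
    domainExt_apply_reduceMod]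
  rw [← Finset.sum_fiberwise_of_maps_to (s := (Finset.univ : Finset (Fin n → ZMod (C * P))))
    (t := (Finset.univ : Finset (Fin n → ZMod P))) (g := reduceMod C) (fun z _ => Finset.mem_univ _)
    (f := fun z => (starRingEnd ℂ) (φ z) * ψ (reduceMod C z))]
  refine Finset.sum_congr rfl fun x _ => ?_
  have hpt : ∀ z : Fin n → ZMod (C * P),
      (starRingEnd ℂ) (if reduceMod C z = x then φ z else 0) * ψ x
        = if reduceMod C z = x then (starRingEnd ℂ) (φ z) * ψ (reduceMod C z) else 0 := by
    intro z
    split_ifs with hz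
    · rw [hz]
    · simp
  rw [Finset.sum_congr rfl fun z _ => hpt z, Finset.sum_filter]

/-- **The extension is `C^{n/2}` times an isometry:** `⟨domainExt C ψ | domainExt C ψ'⟩ = Cⁿ·⟨ψ | ψ'⟩`
(Lemma 2.17's map `|x⟩ ↦ C^{-n/2} Σ_h |x + P·h⟩` is an isometry). [cite: ChenQuantumLattice2024, Lemma 2.17 p. 14] -/
theorem dotProduct_domainExt_domainExt {n P : ℕ} (C : ℕ) [NeZero P] [NeZero (C * P)] (ψ ψ' : Ket n P) :
    star (domainExt C ψ) ⬝ᵥ domainExt C ψ' = ((C : ℂ) ^ n) * (star ψ ⬝ᵥ ψ') := by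
  rw [← dotProduct_domainExtAdj_left, domainExtAdj_domainExt]
  simp only [dotProduct, Pi.star_apply, Pi.smul_apply, smul_eq_mul, star_mul', Complex.star_def,
    map_pow, map_natCast, Finset.mul_sum, mul_assoc]

/-! ### (8.ii)⁻¹ for Chen's shape: "multiply the register by `D`" -/

namespace Shape

variable (S : Shape)

/-- `z ∈ Dℤⁿ⁺¹ ⊂ ℤ_{DM}ⁿ⁺¹` (every canonical representative divisible by `D`): the span on which (8.ii) acts —
`|φ7.a⟩` lives there (`phi7a_apply_ne_zero`; p. 33 "we will always get `0ⁿ mod D`").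
[cite: ChenQuantumLattice2024, §3.5.8 p. 33] -/
def InDZ (z : Fin (S.n + 1) → ZMod ((S.D : ℕ) * S.M)) : Prop := ∀ i, (S.D : ℕ) ∣ (z i).val

/-- decidability of `InDZ` (finitely many divisibilities). [cite: ChenQuantumLattice2024, §3.5.8 p. 33] -/
instance InDZ.decidable (z : Fin (S.n + 1) → ZMod ((S.D : ℕ) * S.M)) : Decidable (S.InDZ z) := by
  unfold InDZ; infer_instance

/-- The point `D·y ∈ ℤ_{DM}ⁿ⁺¹` of a point `y ∈ ℤ_Mⁿ⁺¹` (the relabelling `|y⟩ ↦ |D·y⟩`).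
[cite: ChenQuantumLattice2024, §3.5.8 p. 33] -/
def scalePt (y : Fin (S.n + 1) → ZMod S.M) : Fin (S.n + 1) → ZMod ((S.D : ℕ) * S.M) :=
  fun i => ((((S.D : ℕ) * (y i).val : ℕ)) : ZMod ((S.D : ℕ) * S.M))

/-- The point `z/D ∈ ℤ_Mⁿ⁺¹` of a point `z ∈ Dℤⁿ⁺¹ ⊂ ℤ_{DM}ⁿ⁺¹` (the relabelling `|D·y⟩ ↦ |y⟩` of (8.ii)).
[cite: ChenQuantumLattice2024, §3.5.8 p. 33] -/
def unscalePt (z : Fin (S.n + 1) → ZMod ((S.D : ℕ) * S.M)) : Fin (S.n + 1) → ZMod S.M :=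
  fun i => ((((z i).val / (S.D : ℕ) : ℕ)) : ZMod S.M)

/-- `(D·y)_i` has canonical representative `D·(y_i).val`. [folklore] -/
theorem scalePt_val (y : Fin (S.n + 1) → ZMod S.M) (i : Fin (S.n + 1)) :
    (S.scalePt y i).val = (S.D : ℕ) * (y i).val :=
  ZMod.val_cast_of_lt (Nat.mul_lt_mul_of_pos_left (ZMod.val_lt (y i)) S.D.pos)

/-- `D·y ∈ Dℤⁿ⁺¹`. [folklore] -/
theorem inDZ_scalePt (y : Fin (S.n + 1) → ZMod S.M) : S.InDZ (S.scalePt y) :=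
  fun i => by rw [S.scalePt_val]; exact dvd_mul_right _ _

/-- `(D·y)/D = y`. [folklore] -/
theorem unscalePt_scalePt (y : Fin (S.n + 1) → ZMod S.M) : S.unscalePt (S.scalePt y) = y := by
  funext i
  simp only [unscalePt, S.scalePt_val, Nat.mul_div_cancel_left _ S.D.pos, ZMod.natCast_zmod_val]

/-- `D·(z/D) = z` for `z ∈ Dℤⁿ⁺¹`. [folklore] -/
theorem scalePt_unscalePt {z : Fin (S.n + 1) → ZMod ((S.D : ℕ) * S.M)} (hz : S.InDZ z) :
    S.scalePt (S.unscalePt z) = z := by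
  funext i
  have hlt : (z i).val / (S.D : ℕ) < (S.M : ℕ) := Nat.div_lt_of_lt_mul (ZMod.val_lt (z i))
  simp only [scalePt, unscalePt, ZMod.val_cast_of_lt hlt, Nat.mul_div_cancel' (hz i), ZMod.natCast_zmod_val]

/-- (8.ii) on amplitudes (restated): `divideByD ψ (y) = ψ (D·y)`. [cite: ChenQuantumLattice2024, §3.5.8 p. 33] -/
theorem divideByD_apply (ψ : Ket (S.n + 1) ((S.D : ℕ) * S.M)) (y : Fin (S.n + 1) → ZMod S.M) :
    S.divideByD ψ y = ψ (S.scalePt y) := rfl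

/-- (8.ii)⁻¹ "MULTIPLY THE REGISTER BY `D`" (p. 33: "we just 'multiply by D' by creating `|0ⁿ mod D⟩` and
interpreting them as the LSBs"): `|y⟩ ↦ |D·y⟩`; on amplitudes, the new amplitude at `z ∈ Dℤⁿ⁺¹` is the old one
at `z/D`, and `0` off `Dℤⁿ⁺¹`. [cite: ChenQuantumLattice2024, §3.5.8 p. 33] -/
noncomputable def multiplyByD (ψ : Ket (S.n + 1) S.M) : Ket (S.n + 1) ((S.D : ℕ) * S.M) :=
  fun z => if S.InDZ z then ψ (S.unscalePt z) else 0

/-- `multiplyByD ψ (z) = [z ∈ Dℤ]·ψ(z/D)`. [cite: ChenQuantumLattice2024, §3.5.8 p. 33] -/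
theorem multiplyByD_apply (ψ : Ket (S.n + 1) S.M) (z : Fin (S.n + 1) → ZMod ((S.D : ℕ) * S.M)) :
    S.multiplyByD ψ z = if S.InDZ z then ψ (S.unscalePt z) else 0 := rfl

/-- "Multiply by `D`" is linear. [folklore] -/
theorem multiplyByD_const_smul (c : ℂ) (ψ : Ket (S.n + 1) S.M) :
    S.multiplyByD (c • ψ) = c • S.multiplyByD ψ := by
  funext z
  simp only [multiplyByD_apply, Pi.smul_apply, smul_eq_mul, mul_ite, mul_zero]

/-- **`divideByD ∘ multiplyByD = id`:** dividing after multiplying returns every state.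
[cite: ChenQuantumLattice2024, §3.5.8 p. 33] -/
theorem divideByD_multiplyByD (ψ : Ket (S.n + 1) S.M) : S.divideByD (S.multiplyByD ψ) = ψ := by
  funext y
  rw [divideByD_apply, multiplyByD_apply, if_pos (S.inDZ_scalePt y), unscalePt_scalePt]

/-- **`multiplyByD ∘ divideByD = id` on the states supported in `Dℤⁿ⁺¹`** — the states (8.ii) is applied to
(p. 33: "we can do so because `2Djx + v′ + (M/2)k ∈ Dℤⁿ`"). [cite: ChenQuantumLattice2024, §3.5.8 p. 33] -/
theorem multiplyByD_divideByD {φ : Ket (S.n + 1) ((S.D : ℕ) * S.M)} (hφ : ∀ z, φ z ≠ 0 → S.InDZ z) :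
    S.multiplyByD (S.divideByD φ) = φ := by
  funext z
  rw [multiplyByD_apply, divideByD_apply]
  by_cases hz : S.InDZ z
  · rw [if_pos hz, S.scalePt_unscalePt hz]
  · rw [if_neg hz]
    by_contra hne
    exact hz (hφ z (fun h0 => hne h0.symm))

/-- **"Multiply by `D`" is the adjoint of "divide by `D`":** `⟨multiplyByD ψ | φ⟩ = ⟨ψ | divideByD φ⟩`.
[cite: ChenQuantumLattice2024, §3.5.8 p. 33] -/
theorem dotProduct_multiplyByD_left (ψ : Ket (S.n + 1) S.M) (φ : Ket (S.n + 1) ((S.D : ℕ) * S.M)) :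
    star (S.multiplyByD ψ) ⬝ᵥ φ = star ψ ⬝ᵥ S.divideByD φ := by
  classical
  simp only [dotProduct, Pi.star_apply, Complex.star_def, multiplyByD_apply, divideByD_apply]
  have hpt : ∀ z : Fin (S.n + 1) → ZMod ((S.D : ℕ) * S.M),
      (starRingEnd ℂ) (if S.InDZ z then ψ (S.unscalePt z) else 0) * φ z
        = if S.InDZ z then (starRingEnd ℂ) (ψ (S.unscalePt z)) * φ z else 0 := by
    intro z
    split_ifs <;> simp
  rw [Finset.sum_congr rfl fun z _ => hpt z, ← Finset.sum_filter]
  symm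
  refine Finset.sum_nbij' (fun y => S.scalePt y) (fun z => S.unscalePt z) (fun y _ => ?_) (fun z _ => ?_)
    (fun y _ => S.unscalePt_scalePt y) (fun z hz => S.scalePt_unscalePt (Finset.mem_filter.1 hz).2)
    (fun y _ => by rw [S.unscalePt_scalePt y])
  · exact Finset.mem_filter.2 ⟨Finset.mem_univ _, S.inDZ_scalePt y⟩
  · exact Finset.mem_univ _

/-- **"Multiply by `D`" is an isometry:** `⟨multiplyByD ψ | multiplyByD ψ'⟩ = ⟨ψ | ψ'⟩`.
[cite: ChenQuantumLattice2024, §3.5.8 p. 33] -/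
theorem dotProduct_multiplyByD_multiplyByD (ψ ψ' : Ket (S.n + 1) S.M) :
    star (S.multiplyByD ψ) ⬝ᵥ S.multiplyByD ψ' = star ψ ⬝ᵥ ψ' := by
  rw [dotProduct_multiplyByD_left, divideByD_multiplyByD]

/-- A state extended by Lemma 2.17 is supported in `Dℤⁿ⁺¹ ⊂ ℤ_{DM}ⁿ⁺¹` iff the original is supported in
`Dℤ_M ⁿ⁺¹` (as `D ∣ M`): the hypothesis under which (8.ii) is a mere relabelling. [cite: ChenQuantumLattice2024, §3.5.8 p. 33] -/
theorem inDZ_of_domainExt_ne_zero {ψ : Ket (S.n + 1) S.M} (hψ : ∀ x, ψ x ≠ 0 → ∀ i, (S.D : ℕ) ∣ (x i).val)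
    (z : Fin (S.n + 1) → ZMod ((S.D : ℕ) * S.M)) (hz : domainExt (S.D : ℕ) ψ z ≠ 0) : S.InDZ z := by
  intro i
  have h := hψ _ hz i
  simp only [ZMod.castHom_apply, ZMod.cast_eq_val, ZMod.val_natCast] at h
  exact (Nat.dvd_mod_iff ⟨2 * (S.D * S.P : ℕ), by rw [S.M_nat]; ring⟩).1 h

/-- `|φ7⟩` is supported in `Dℤ_Mⁿ⁺¹` (its points are `D·ctr j k`, `pt7_eq_D_mul_ctr`).
[cite: ChenQuantumLattice2024, eq. (35) p. 31, §3.5.8 p. 33] -/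
theorem phi7_apply_ne_zero (h : S.Admissible) (x : Fin (S.n + 1) → ZMod S.M) (hx : S.phi7 x ≠ 0)
    (i : Fin (S.n + 1)) : (S.D : ℕ) ∣ (x i).val := by
  have hlt : (x i).val < (S.D : ℕ) * S.M :=
    (ZMod.val_lt (x i)).trans_le (Nat.le_mul_of_pos_left _ S.D.pos)
  have key := S.phi7a_apply_ne_zero h (fun i => (((x i).val : ℕ) : ZMod ((S.D : ℕ) * S.M))) ?_ i
  · simpa only [ZMod.val_cast_of_lt hlt] using key
  · unfold phi7a domainExt
    simp only [map_natCast, ZMod.natCast_zmod_val]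
    exact hx

/-- `multiplyByD |φ7.b⟩ = |φ7.a⟩`: on the actual run, (8.ii) is undone exactly. [cite: ChenQuantumLattice2024, §3.5.8 p. 33] -/
theorem multiplyByD_phi7b (h : S.Admissible) : S.multiplyByD S.phi7b = S.phi7a :=
  S.multiplyByD_divideByD fun z hz => S.phi7a_apply_ne_zero h z hz

/-! ### The fifth operation (p. 34) is sure and disturbs nothing -/

/-- Chen's Step-8 read-out statistic, computed into the new register by the fifth operation: `w ↦ w₀ mod Dp₁`.
[cite: ChenQuantumLattice2024, §3.5.8 p. 34] -/
def read8 (w : Fin (S.n + 1) → ZMod S.M) : ZMod ((S.D : ℕ) * S.p₁) :=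
  (((w 0).val : ℤ) : ZMod ((S.D : ℕ) * S.p₁))

/-- Its sure value `w′₁ = v′₀/D mod Dp₁` (p. 34). [cite: ChenQuantumLattice2024, §3.5.8 p. 34, Claim 3.14 p. 33] -/
def read8Value : ZMod ((S.D : ℕ) * S.p₁) := ((S.omega : ℤ) : ZMod ((S.D : ℕ) * S.p₁))

/-- THE FIFTH OPERATION (p. 34: "we compute `w₁ mod Dp₁` in a new register, then measure the new register"):
its Lüders branch on the main register for the outcome `r` is the projector onto the basis vectors `|w⟩` with
`w₀ ≡ r (mod Dp₁)` — `|φ⟩ ↦ 𝟙_{read8 = r}·|φ⟩` (the branch operator `branchOp` of `ChenQuantumLWENonDemolition`).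
[cite: ChenQuantumLattice2024, §3.5.8 p. 34] -/
noncomputable def fifthOp (r : ZMod ((S.D : ℕ) * S.p₁)) (φ : Ket (S.n + 1) S.M) : Ket (S.n + 1) S.M :=
  {w | S.read8 w = r}.indicator φ

/-- On the support of `|φ7.d⟩` the read-out is `read8Value` (third congruence of Claim 3.14).
[cite: ChenQuantumLattice2024, Claim 3.14 p. 33] -/
theorem read8_eq_of_phi7d_ne_zero (h : S.Admissible) {w : Fin (S.n + 1) → ZMod S.M} (hw : S.phi7d w ≠ 0) :
    S.read8 w = S.read8Value :=
  (S.claim314_phi7d h w hw).2.2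

/-- **The fifth operation is sure and non-demolition:** `fifthOp r |φ7.d⟩ = |φ7.d⟩` for `r = read8Value` and `= 0`
for every other outcome — the new register reads `v′₀/D mod Dp₁` with certainty and the residual state is
`|φ7.e⟩ = |φ7.d⟩` (p. 34), exactly. [cite: ChenQuantumLattice2024, Lemma 3.13 p. 32, §3.5.8 p. 34] -/
theorem fifthOp_phi7d (h : S.Admissible) (r : ZMod ((S.D : ℕ) * S.p₁)) :
    S.fifthOp r S.phi7d = if r = S.read8Value then S.phi7d else 0 := by
  classical
  funext w
  simp only [fifthOp, Set.indicator_apply, Set.mem_setOf_eq, ite_apply, Pi.zero_apply]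
  by_cases hw : S.phi7d w = 0
  · simp only [hw, ite_self]
  · have hread := S.read8_eq_of_phi7d_ne_zero h hw
    split_ifs with h1 h2 h2
    · rfl
    · exact absurd (h1.symm.trans hread) h2
    · exact absurd (hread.trans h2.symm) h1
    · rfl

/-- `|φ7.e⟩ = |φ7.d⟩`: the branch that occurs is the whole state. [cite: ChenQuantumLattice2024, §3.5.8 p. 34] -/
theorem fifthOp_read8Value_phi7d (h : S.Admissible) : S.fifthOp S.read8Value S.phi7d = S.phi7d := by
  rw [S.fifthOp_phi7d h, if_pos rfl]

/-- In the vocabulary of `ChenQuantumLWENonDisturbing`: every branch of the fifth operation is non-disturbing on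
`|φ7.d⟩`. [cite: ChenQuantumLattice2024, Lemma 3.13 p. 32, §3.5.8 p. 34] -/
theorem isNonDisturbing_fifthOp (h : S.Admissible) (r : ZMod ((S.D : ℕ) * S.p₁)) :
    IsNonDisturbing {w | S.read8 w = r} S.phi7d := by
  by_cases hr : r = S.read8Value
  · exact ⟨1, by rw [one_smul]; exact (S.fifthOp_phi7d h r).trans (if_pos hr)⟩
  · exact ⟨0, by rw [zero_smul]; exact (S.fifthOp_phi7d h r).trans (if_neg hr)⟩

/-- **Born weights of the fifth operation:** outcome `read8Value` carries the total weight of `|φ7.d⟩` (which is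
positive, `phi7d_ne_zero`), every other outcome weight `0`. [cite: ChenQuantumLattice2024, §3.5.8 p. 34] -/
theorem fifthOp_weight (h : S.Admissible) (r : ZMod ((S.D : ℕ) * S.p₁)) :
    ∑ w, ‖S.fifthOp r S.phi7d w‖ ^ 2 = if r = S.read8Value then ∑ w, ‖S.phi7d w‖ ^ 2 else 0 := by
  rw [S.fifthOp_phi7d h]
  split_ifs
  · rfl
  · simp

/-- **What the fifth operation reads is `v′₀ mod D²p₁`:** `step8Output = D · read8Value` (the register's
"modulo-`D` part" being `0`, p. 33, the digit `w′₁ = v′₀/D mod Dp₁` IS `v′₀ mod D²p₁`; Lemma 3.13's output).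
[cite: ChenQuantumLattice2024, Lemma 3.13 p. 32, §3.5.8 p. 34] -/
theorem step8Output_eq_D_mul_read8Value (h : S.Admissible) :
    S.step8Output = ((((S.D : ℕ) * S.read8Value.val : ℕ)) : ZMod ((S.D : ℕ) ^ 2 * S.p₁)) := by
  unfold step8Output read8Value
  rw [← Int.cast_natCast, ZMod.intCast_eq_intCast_iff_dvd_sub]
  push_cast
  rw [ZMod.val_intCast]
  have hω : (S.D : ℤ) * S.omega = S.v' 0 := Int.mul_ediv_cancel' (h.v'_in_DZ 0)
  have hq := Int.mul_ediv_add_emod S.omega (((S.D : ℕ) * S.p₁ : ℕ) : ℤ)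
  refine ⟨-(S.omega / (((S.D : ℕ) * S.p₁ : ℕ) : ℤ)), ?_⟩
  push_cast at hq ⊢
  linear_combination (S.D : ℤ) * hq + hω

/-! ### Reversing the four operations returns `|φ7⟩` -/

/-- The four operations (8.i)–(8.iv) as one map on input states: extend by `D`, divide by `D`, kick, `QFT`
(`forward8 |φ7⟩ = |φ7.d⟩` by definition). [cite: ChenQuantumLattice2024, §3.5.8 pp. 32–33] -/
noncomputable def forward8 (ψ : Ket (S.n + 1) S.M) : Ket (S.n + 1) S.M :=
  qft (kick S.kick8 (S.divideByD (domainExt (S.D : ℕ) ψ)))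

/-- `forward8 |φ7⟩ = |φ7.d⟩`. [cite: ChenQuantumLattice2024, §3.5.8 pp. 32–33] -/
theorem forward8_phi7 : S.forward8 S.phi7 = S.phi7d := rfl

/-- THE REVERSAL of the four operations (p. 34: "Next we reverse the previous four operations"), each by its
adjoint, in reverse order: `QFT⁻¹` (8.iv)⁻¹, the opposite kick `e(−y₀²/(2M))` (8.iii)⁻¹, "multiply by `D`" (8.ii)⁻¹,
the un-extension (8.i)⁻¹. [cite: ChenQuantumLattice2024, Lemma 3.13 p. 32, §3.5.8 p. 34] -/
noncomputable def reverse8 (φ : Ket (S.n + 1) S.M) : Ket (S.n + 1) S.M :=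
  domainExtAdj (S.D : ℕ) (S.multiplyByD (kick (fun y => -S.kick8 y) (qftInv φ)))

/-- The scalar picked up by `reverse8 ∘ forward8`: `(D·M)^{n+1}` = (`QFT⁻¹QFT = M^{n+1}`) × (un-extension ∘
extension `= D^{n+1}`); the physical maps are these divided by `√` of their factors. [cite: ChenQuantumLattice2024, Lemma 2.12 p. 12, Lemma 2.17 p. 14] -/
def scalar8 : ℂ := ((((S.D : ℕ) : ℂ)) * ((S.M : ℕ) : ℂ)) ^ (S.n + 1)

/-- `scalar8 ≠ 0`. [folklore] -/
theorem scalar8_ne_zero : S.scalar8 ≠ 0 :=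
  pow_ne_zero _ (mul_ne_zero (Nat.cast_ne_zero.2 S.D.ne_zero) (Nat.cast_ne_zero.2 S.M.ne_zero))

/-- **The four operations are reversible on every input supported in `Dℤ_Mⁿ⁺¹`:**
`reverse8 (forward8 ψ) = (DM)^{n+1} • ψ`. [cite: ChenQuantumLattice2024, Lemma 3.13 p. 32, §3.5.8 pp. 32–34] -/
theorem reverse8_forward8 (ψ : Ket (S.n + 1) S.M) (hψ : ∀ x, ψ x ≠ 0 → ∀ i, (S.D : ℕ) ∣ (x i).val) :
    S.reverse8 (S.forward8 ψ) = S.scalar8 • ψ := by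
  unfold reverse8 forward8
  rw [qftInv_qft, kick_const_smul, kick_neg_kick, multiplyByD_const_smul,
    S.multiplyByD_divideByD (S.inDZ_of_domainExt_ne_zero hψ), ← domainExt_const_smul,
    domainExtAdj_domainExt, smul_smul, scalar8, mul_pow, mul_comm]

/-- **`reverse8` is the adjoint of `forward8`:** reversing the four operations IS running their circuit
backwards — `⟨reverse8 φ | ψ⟩ = ⟨φ | forward8 ψ⟩` for all states. [cite: ChenQuantumLattice2024, Lemma 3.13 p. 32, §3.5.8 p. 34] -/
theorem dotProduct_reverse8_left (φ ψ : Ket (S.n + 1) S.M) :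
    star (S.reverse8 φ) ⬝ᵥ ψ = star φ ⬝ᵥ S.forward8 ψ := by
  unfold reverse8 forward8
  rw [dotProduct_domainExtAdj_left, dotProduct_multiplyByD_left, dotProduct_kick_neg_left,
    dotProduct_qftInv_left]

/-- **The four operations are `(DM)^{(n+1)/2}` times an isometry on the inputs supported in `Dℤ_Mⁿ⁺¹`:**
`⟨forward8 ψ | forward8 ψ'⟩ = (DM)^{n+1}·⟨ψ | ψ'⟩` — "we will make sure that the four operations are reversible"
(p. 32). [cite: ChenQuantumLattice2024, Lemma 3.13 p. 32] -/
theorem dotProduct_forward8_forward8 (ψ ψ' : Ket (S.n + 1) S.M)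
    (hψ : ∀ x, ψ x ≠ 0 → ∀ i, (S.D : ℕ) ∣ (x i).val) :
    star (S.forward8 ψ) ⬝ᵥ S.forward8 ψ' = S.scalar8 * (star ψ ⬝ᵥ ψ') := by
  rw [← dotProduct_reverse8_left, S.reverse8_forward8 ψ hψ, star_smul, smul_dotProduct, smul_eq_mul]
  congr 1
  simp only [scalar8, Complex.star_def, map_pow, map_mul, map_natCast]

/-- **Lemma 3.13, second half: Step 8 returns `|φ7⟩`.**  After the sure fifth operation, reversing (8.iv)–(8.i)
gives back `|φ8⟩ = |φ7⟩` exactly (as a ray: `(DM)^{n+1} • |φ7⟩`, `scalar8_ne_zero`).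
[cite: ChenQuantumLattice2024, Lemma 3.13 p. 32, §3.5.8 p. 34] -/
theorem reverse8_fifthOp_phi7d (h : S.Admissible) :
    S.reverse8 (S.fifthOp S.read8Value S.phi7d) = S.scalar8 • S.phi7 := by
  rw [S.fifthOp_read8Value_phi7d h, ← forward8_phi7]
  exact S.reverse8_forward8 S.phi7 (S.phi7_apply_ne_zero h)

/-- The state handed to the un-extension lies in the range of Lemma 2.17's extension — it is
`M^{n+1} • |φ7.a⟩ = domainExt D (M^{n+1} • |φ7⟩)` — so the reversed extension circuit returns its digit register to
the prepared state with certainty. [cite: ChenQuantumLattice2024, Lemma 2.17 p. 14, §3.5.8 p. 34] -/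
theorem before_unextension_eq (h : S.Admissible) :
    S.multiplyByD (kick (fun y => -S.kick8 y) (qftInv (S.fifthOp S.read8Value S.phi7d)))
      = domainExt (S.D : ℕ) ((((S.M : ℕ) : ℂ) ^ (S.n + 1)) • S.phi7) := by
  rw [S.fifthOp_read8Value_phi7d h]
  unfold phi7d phi7c
  rw [qftInv_qft, kick_const_smul, kick_neg_kick, multiplyByD_const_smul, S.multiplyByD_phi7b h,
    domainExt_const_smul]
  rfl

/-- **Lemma 3.13 (p. 32) in full, for the state `|φ7⟩` of eq. (35):** (i) the fifth operation's outcome is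
`read8Value = v′₀/D mod Dp₁` surely and its branch is the identity on `|φ7.d⟩` (no collapse); (ii) the value read
is `v′₀ mod D²p₁ = step8Output`; (iii) reversing the four operations returns `c • |φ7⟩`, `c ≠ 0`: "we learn
`v′₁ mod D²p₁` without affecting the state `|φ7⟩` at all" (p. 34) — kernel-checked.  (Claim 3.14 itself:
`claim314_phi7d`.) [cite: ChenQuantumLattice2024, Lemma 3.13 p. 32, Claim 3.14 p. 33, §3.5.8 p. 34] -/
theorem lemma313 (h : S.Admissible) :
    (∀ r, S.fifthOp r S.phi7d = if r = S.read8Value then S.phi7d else 0)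
    ∧ S.step8Output = ((((S.D : ℕ) * S.read8Value.val : ℕ)) : ZMod ((S.D : ℕ) ^ 2 * S.p₁))
    ∧ ∃ c : ℂ, c ≠ 0 ∧ S.reverse8 (S.fifthOp S.read8Value S.phi7d) = c • S.phi7 :=
  ⟨S.fifthOp_phi7d h, S.step8Output_eq_D_mul_read8Value h, S.scalar8, S.scalar8_ne_zero,
    S.reverse8_fifthOp_phi7d h⟩

end Shape

end Literature.Computability.Cryptography.Chen2024
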